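import Summits.CriticalPhenomena.PercolationContinuityZ3.Theorems.FK.SamePConditionalDriver
import Summits.CriticalPhenomena.PercolationContinuityZ3.Theorems.FK.InfiniteVolumeGibbs
import Summits.CriticalPhenomena.PercolationContinuityZ3.Theorems.FK.EdgeDensityDerivative
import Summits.CriticalPhenomena.PercolationContinuityZ3.Theorems.FK.RandomClusterFiniteEnergy
import Summits.CriticalPhenomena.PercolationContinuityZ3.Theorems.FK.ContinuityQOneBridge
import Literature.Barriers.CriticalPhenomena.RandomClusterFirstOrderProofs
import Literature.Probability.Percolation.SharpnessDCTProofs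
import HarnessLib

/-!
# FK-continuity transplant, FO-11 (3/4): the same-`p` continuation principle for the random-cluster
# model, `q ≥ 1` — a region-lawful bounded exploration scheme at `p` forces `p_c(q) < p`

Cell `fk-continuity` (bschramm), row FO-11 = crux shape C2 of the cell's SCOPING.md §3.6; support file for
the FK-continuity transplant (`--supports stmt-CriticalPhenomena-4575`); builds on p205010 (kernel theorem,
internal audit signed; external expert review pending).  No named facts, no sorries, standard axioms.  New
mathematics of the lane in the sense of the tree's `PercNearOneGluingNoHeavySamePContinuation.lean` (the
`q = 1` continuation principle `SameP.criticalProb_lt_of_lawful`), of which this file is the random-cluster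
version; the published ingredients are Kozma–Nitzan's exploration process (arXiv:2401.12397 §4 p. 25 and §1
p. 2, "approach 1": openness of `{p : θ(p) > 0}` from a finite-size criterion), Grimmett 2006 Lemma (4.13)
with Lemma (4.14)(b) (domain Markov property and comparison of boundary conditions — the cell's `FKGibbs`
sandwich, file `InfiniteVolumeGibbs.lean`), Thm (2.43)/(2.44) (Lipschitz continuity in `p` of finite-volume
random-cluster probabilities — the cell's `EdgeDensityDerivative.lean`), Thm (3.1) eq. (3.4) (finite energy —
the cell's `RandomClusterFiniteEnergy.lean`) and Prop. (5.11) (`θ¹ = inf` over wired boxes).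

## The hypothesis: region-lawful schemes (the free-REGION worst case, increasing success events)

`SameP.RegionLawful S p q M ε` for a history-driven scheme `S : HSiteScheme (Site d)` on `ℤ^d`: along every
lattice configuration a probe is made whenever a candidate exists; every success event is INCREASING in the
configuration (the cell's S1-free design: no local-uniqueness / non-monotone probe event); the initial edges
`U₀` lie in `E_{Λ₀}` for some finite `Λ₀`; and after every history `h` whose next probe `P` examines the
macro-edge `e`, there is a finite REGION `Λ ⊆ ℤ^d` of at most `M` sites with `P.env ⊆ E_Λ`, `E_Λ` disjoint
from `U₀` and from every pair revealed by `h`, such that the probe fails with probability at most `ε` under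
the FREE random-cluster measure `φ⁰_{Λ,p,q}` of the region:  `φ⁰_{Λ,p,q}(¬ succ) ≤ ε`.  This is the shape
the cell's crux C1 (`FKRobustLawful`, SCOPING §3.6: "every probe-failure bound holds under the free measure
on the probe envelope, for every history") must imply; it mentions no infinite-volume object and no ambient
threshold (T1⁺).

## Results

* `RegionLawful.condLawful` — for EVERY measure `P` with `FKGibbs d p q P` (the free/wired sandwich form of
  DLR), a region-lawful scheme is conditionally lawful under `P` (`SameP.CondLawful`, file 2): the failure
  event is decreasing and `E_Λ`-measurable, the past is measurable outside `E_Λ`, so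
  `P(fail ∩ past) ≤ φ⁰_Λ(fail) · P(past) ≤ ε · P(past)` (Lemma (4.13)/(4.14)(b)).
* `RegionLawful.of_near` — region-lawfulness is OPEN in `p`: lawful at `(p, ε)` with regions of `≤ M` sites
  and `p, p′ ∈ [δ, 1-δ]` ⇒ lawful at `(p′, ε + C(M,2)/(δ(1-δ)) · |p′ - p|)` (Thm (2.43): each failure
  probability is a finite-volume quantity, Lipschitz in `p` uniformly in the event).
* `real_percolatesAt_le_thetaWired` — for every `FKGibbs` measure, `P(0 ↔ ∞) ≤ θ¹(p,q)` (upper sandwich on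
  each box `Λ_n`, Prop. (5.11)); `regionFreeReal_initEvent_pos`, `FKGibbs.initEvent_pos` — `P(A₀) > 0`.
* **C2** `RegionLawful.exists_lt_forall_fkGibbs_percolates`: a region-lawful scheme at `(p, ε)`, `ε < 2⁻³²`,
  `p ∈ (0,1)`, `q ≥ 1`, whose infinite macro-cluster forces `0 ↔ ∞`, yields `p′ < p` such that EVERY
  `FKGibbs` measure at `(p′, q)` percolates: `P′(0 ↔ ∞) > 0`; hence (`rcCriticalProb_lt_of_regionLawful`)
  `p_c(q) < p` as soon as an `FKGibbs` measure exists at `p′` (the limit `φ⁰_{p′,q}` does: rows FO-06a-2 /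
  FO-06b of the cell, `IsBoxLimit.fkGibbs` + `isBoxLimit_rcLimit`; taken here as the hypothesis `hex`).

No slab, half-space or sprinkling input; no product structure (the `q = 1` case is the tree's theorem via
`SameP.condLawful_of_lawful`).  What is NOT here: the construction of a region-lawful scheme from
`θ⁰(p,q) > 0` (crux C3 = C3a ∘ C3b of the cell; C3a is the FO-19 NO-GO item), and the identification
`P(0 ↔ ∞) = θ^b(p,q)` for the limit measures (row FO-07).

## References

* G. Kozma, S. Nitzan, arXiv:2401.12397 (2024), §1 p. 2 (approach 1), §4 p. 25. [KozmaNitzan2024]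
* G. Grimmett, *The Random-Cluster Model*, Springer 2006: Thm (2.43)/(2.44) p. 34; Thm (3.1) (3.4) p. 38;
  Lemma (4.13) p. 71, Lemma (4.14)(b) p. 72; (5.1)–(5.2), Prop. (5.11) p. 100. [Grimmett2006]
-/

noncomputable section

namespace Summit.CriticalPhenomena.PercolationContinuityZ3.Theorems.FK

open MeasureTheory ProbabilityTheory Literature.Probability.Percolation Literature.Probability.LatticeModels
open Literature.Probability.Percolation.ProbeHistory Literature.Probability.Percolation.HSiteScheme
open Literature.Barriers.CriticalPhenomena
open scoped ENNReal Classical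

namespace SameP

variable {d : ℕ}

/-! ### Region-lawful schemes -/

/-- **Region-lawful schemes at `(p, q)` with regions of at most `M` sites and failure bound `ε`** — the
finite-volume, free-REGION worst-case form of Kozma–Nitzan's clause (4) for the random-cluster model:
probes are made along lattice configurations whenever a candidate exists; success events are increasing;
`U₀ ⊆ E_{Λ₀}` for a finite `Λ₀`; and after every history `h` whose next probe `P` examines `e` there is a
region `Λ` (`|Λ| ≤ M`, `P.env ⊆ E_Λ`, `E_Λ` disjoint from `U₀` and from the pairs revealed by `h`) with
`φ⁰_{Λ,p,q}(¬succ) ≤ ε`.  (Cell SCOPING §3.6, crux C1; the tree's `HSiteScheme.Lawful` is the product-measure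
analogue.) [cite: KozmaNitzan2024, §4 p. 25 (Definition of an exploration process, (3)–(5))] -/
structure RegionLawful (S : HSiteScheme (Site d)) (p q : ℝ) (M : ℕ) (ε : ℝ) : Prop where
  /-- along the run on a lattice configuration, a probe is made whenever a candidate exists -/
  probes : ∀ ω : BondConfig (Site d), ω ⊆ (zdGraph d).edgeSet → ∀ n,
    (S.stN n ω).choice ≠ none → S.E.next (S.E.hist n ω) ≠ none
  /-- success events are increasing -/
  mono : ∀ h P e, S.E.next h = some P → (S.mst h).choice = some e →
    IsUpperSet {ω : BondConfig (Site d) | S.succ h e (P.read ω)}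
  /-- the initial edges lie in the edge set of a finite region -/
  init : ∃ Λ₀ : Finset (Site d), (↑S.U₀ : Set (Sym2 (Site d))) ⊆ ↑(edgesIn (zdGraph d) Λ₀)
  /-- the free-region failure bound after every history -/
  fail : ∀ h P e, S.E.next h = some P → (S.mst h).choice = some e →
    ∃ Λ : Finset (Site d), Λ.card ≤ M ∧ (↑P.env : Set (Sym2 (Site d))) ⊆ ↑(edgesIn (zdGraph d) Λ) ∧
      Disjoint (↑(edgesIn (zdGraph d) Λ) : Set (Sym2 (Site d))) (↑S.U₀ ∪ ↑(supp h)) ∧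
      regionFreeReal d p q Λ {ω | ¬S.succ h e (P.read ω)} ≤ ε

namespace RegionLawful

variable {S : HSiteScheme (Site d)} {p q : ℝ} {M : ℕ} {ε : ℝ}

/-- **Region-lawful ⇒ conditionally lawful under every `FKGibbs` measure** (Grimmett 2006, Lemma (4.13) with
Lemma (4.14)(b), in the cell's sandwich form `FKGibbs.le_free_mul_of_isLowerSet`): the failure event of the
probe after `h` is DECREASING and determined by `E_Λ`, the past `A₀ ∩ {hist n = h}` is determined by
`U₀ ∪ supp h`, disjoint from `E_Λ`; hence `P(past ∩ fail) ≤ φ⁰_{Λ,p,q}(fail) · P(past) ≤ ε · P(past)`.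
[cite: Grimmett2006, Lemma (4.13) and Lemma (4.14)(b)] -/
theorem condLawful (hR : RegionLawful S p q M ε) (hp : p ∈ Set.Icc (0 : ℝ) 1) (hq : 0 < q)
    {P : Measure (BondConfig (Site d))} (hG : FKGibbs d p q P) : CondLawful S P (zdGraph d) ε := by
  refine ⟨hR.probes, hG.ae_subset_edgeSet, fun n h Pr e hP he => ?_⟩
  obtain ⟨Λ, -, henv, hdisj, hε⟩ := hR.fail h Pr e hP he
  set D : Set (BondConfig (Site d)) := {ω | ¬S.succ h e (Pr.read ω)} with hD
  set H : Set (BondConfig (Site d)) := S.initEvent ∩ {ω | S.E.hist n ω = h} with hH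
  have hDlow : IsLowerSet D := fun ω ω' hle hω hω' => hω (hR.mono h Pr e hP he hle hω')
  have hDΛ : DeterminedBy D ↑(edgesIn (zdGraph d) Λ) := (Pr.determinedBy_setOf_read fun o => ¬S.succ h e o).mono henv
  have hDm : MeasurableSet D := Pr.measurableSet_setOf_read fun o => ¬S.succ h e o
  have hT : Disjoint (↑(S.U₀ ∪ supp h) : Set (Sym2 (Site d))) ↑(edgesIn (zdGraph d) Λ) := by
    rw [Finset.coe_union]; exact hdisj.symm
  have hHdet : DeterminedBy H ↑(S.U₀ ∪ supp h) := by
    rw [Finset.coe_union]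
    exact (determinedBy_initEvent.mono Set.subset_union_left).inter
      ((S.E.determinedBy_hist n h).mono Set.subset_union_right)
  have key := hG.le_free_mul_of_isLowerSet hp hq Λ (S.U₀ ∪ supp h) hDlow hDΛ hDm hT hHdet
  have hset : S.initEvent ∩ {ω | S.E.hist n ω = h} ∩ D = D ∩ H := Set.inter_comm _ _
  rw [hset]
  exact key.trans (mul_le_mul_of_nonneg_right hε measureReal_nonneg)

/-- **Region-lawfulness is an open condition in `p`** (Grimmett 2006, Thm (2.43): on `[δ, 1-δ]` the
`φ_{Λ,p,q}`-probability of ANY event is Lipschitz in `p` with constant `|E_Λ|/(δ(1-δ)) ≤ C(M,2)/(δ(1-δ))`, the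
cell's `FK.abs_rcMeasure_real_sub_le_of_mem_Icc`): a scheme region-lawful at `(p, ε)` is region-lawful at
`(p′, ε + C(M,2)/(δ(1-δ))·|p′ - p|)` — the regions, candidates and success events do not involve `p`.
[cite: Grimmett2006, Thm (2.43)/(2.44)] -/
theorem of_near (hR : RegionLawful S p q M ε) (hq : 0 < q) {δ : ℝ} (hδ : 0 < δ)
    (hp : p ∈ Set.Icc δ (1 - δ)) {p' : ℝ} (hp' : p' ∈ Set.Icc δ (1 - δ)) :
    RegionLawful S p' q M (ε + (M.choose 2 : ℝ) / (δ * (1 - δ)) * |p' - p|) := by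
  refine ⟨hR.probes, hR.mono, hR.init, fun h Pr e hP he => ?_⟩
  obtain ⟨Λ, hM, henv, hdisj, hε⟩ := hR.fail h Pr e hP he
  refine ⟨Λ, hM, henv, hdisj, ?_⟩
  have hδ1 : 0 < 1 - δ := by linarith [hp.1.trans hp.2]
  set A := liftEdges Λ ⁻¹' {ω : BondConfig (Site d) | ¬S.succ h e (Pr.read ω)} with hA
  have hlip := abs_rcMeasure_real_sub_le_of_mem_Icc (finsetGraph (zdGraph d) Λ) hq (∅ : Set ↥Λ) A hδ hp hp'
  have hcard : ((finsetGraph (zdGraph d) Λ).edgeFinset.card : ℝ) ≤ (M.choose 2 : ℝ) := by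
    have h1 := (finsetGraph (zdGraph d) Λ).card_edgeFinset_le_card_choose_two
    rw [Fintype.card_coe] at h1
    exact_mod_cast h1.trans (Nat.choose_le_choose 2 hM)
  have hcoef : ((finsetGraph (zdGraph d) Λ).edgeFinset.card : ℝ) / (δ * (1 - δ)) * |p' - p| ≤
      (M.choose 2 : ℝ) / (δ * (1 - δ)) * |p' - p| :=
    mul_le_mul_of_nonneg_right (div_le_div_of_nonneg_right hcard (mul_pos hδ hδ1).le) (abs_nonneg _)
  change (rcMeasure (finsetGraph (zdGraph d) Λ) p' q ∅).real A ≤ _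
  change (rcMeasure (finsetGraph (zdGraph d) Λ) p q ∅).real A ≤ ε at hε
  linarith [(abs_le.1 hlip).2]

end RegionLawful

/-! ### Events read through the lattice edges -/

/-- If `A` is determined by `F`, then "`ω ∩ E ∈ A`" is determined by `F ∩ E`. [folklore] -/
theorem determinedBy_preimage_inter_right {A : Set (BondConfig (Site d))} {F : Set (Sym2 (Site d))}
    (hA : DeterminedBy A F) (E : Set (Sym2 (Site d))) :
    DeterminedBy ((fun ω : BondConfig (Site d) => ω ∩ E) ⁻¹' A) (F ∩ E) := by
  rw [determinedBy_iff] at hA ⊢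
  intro ω ω' h
  simp only [Set.mem_preimage]
  refine hA _ _ ?_
  rw [Set.inter_assoc, Set.inter_assoc, Set.inter_comm E F]
  exact h

/-! ### Every `FKGibbs` measure percolates at most as much as `θ¹` -/

/-- **`P(0 ↔ ∞) ≤ θ¹(p,q)` for every `FKGibbs` measure `P` at `(p,q)`** (Grimmett 2006, proof of Prop. (5.11):
`φ(0 ↔ ∞) ≤ φ(0 ↔ ∂Λ_n) ≤ φ¹_{Λ_n,p,q}(0 ↔ ∂Λ_n)` by the upper sandwich on the box `Λ_n`, for every `n`;
`θ¹ = inf_n`).  Only the one-sided bound; the identification `φ^b(0 ↔ ∞) = θ^b` for the limit measures is row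
FO-07 of the cell. [cite: Grimmett2006, Prop. (5.11) (proof) and Thm. (4.19)(c) (4.21)] -/
theorem real_percolatesAt_le_thetaWired {p q : ℝ} {P : Measure (BondConfig (Site d))} (hG : FKGibbs d p q P)
    (hp : p ∈ Set.Icc (0 : ℝ) 1) (hq : 0 < q) : P.real (percolatesAt (0 : Site d)) ≤ thetaWired d p q := by
  haveI := hG.isProbabilityMeasure
  unfold thetaWired
  refine le_ciInf fun n => ?_
  set m := n + 1 with hm
  set E : Set (Sym2 (Site d)) := (zdGraph d).edgeSet with hE
  set A : Set (BondConfig (Site d)) := (fun ω => ω ∩ E) ⁻¹' siteToBoundary d m with hA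
  -- `{0 ↔ ∞} ⊆ A` almost surely
  have h1 : P.real (percolatesAt (0 : Site d)) ≤ P.real A := by
    simp only [measureReal_def]
    refine ENNReal.toReal_mono (measure_ne_top _ _) (measure_mono_ae ?_)
    filter_upwards [hG.ae_subset_edgeSet] with ω hωE
    intro hperc
    show ω ∩ E ∈ siteToBoundary d m
    rw [Set.inter_eq_self_of_subset_left hωE]
    -- first exit: an infinite open lattice cluster at `0` leaves `Λ_m` (the tree's one-arm argument, cf.
    -- `DCT16.theta_le_real_siteToBoundary` and the cell's `mem_siteToBoundary_of_mem_percolatesAt`)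
    obtain ⟨z, hz, hzn⟩ : ∃ z ∈ openCluster ω 0, z ∉ box d m := by
      by_contra hcon
      push Not at hcon
      exact hperc ((box d m).finite_toSet.subset fun z hz => Finset.mem_coe.2 (hcon z hz))
    rw [← DCT16.armEvent_zero]
    exact DCT16.armEvent_of_pathIn hωE (DCT16.pathIn_univ_of_reachable hz) (Or.inl (by rwa [sub_zero]))
  -- `A` is increasing and determined by `E_{Λ_m}`
  have hAup : IsUpperSet A := fun ω ω' hle hω =>
    DCT16.isUpperSet_siteToBoundary d m (Set.inter_subset_inter_left E hle) hω
  have hAdet : DeterminedBy A ↑(edgesIn (zdGraph d) (box d m)) := by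
    refine (determinedBy_preimage_inter_right (DCT16.determinedBy_siteToBoundary d m) E).mono ?_
    rintro e ⟨he1, he2⟩
    rw [Finset.mem_coe, mem_edgesIn_iff]
    exact ⟨he2, fun x hx => Finset.mem_sym2_iff.1 (Finset.mem_coe.1 he1) x hx⟩
  have h2 : P.real A ≤ regionWiredReal d p q (box d m) A := hG.le_regionWiredReal (box d m) hAup hAdet
  -- the pull-back of `A` to the box is contained in `{0 ↔ ∂Λ_m}`
  have h3 : regionWiredReal d p q (box d m) A ≤ thetaWiredBox d p q m := by
    haveI := isProbabilityMeasure_rcMeasure (finsetGraph (zdGraph d) (box d m)) hp hq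
      (wiredBoundary (zdGraph d) (box d m))
    rw [thetaWiredBox_eq_general, regionWiredReal]
    refine measureReal_mono ?_ (measure_ne_top _ _)
    intro ω hω
    have hω' : liftEdges (box d m) ω ∩ E ∈
        restrictConfig (Subtype.val : BoxV d m → Site d) ⁻¹' originToBoundary d m := by
      rw [preimage_restrictConfig_originToBoundary]; exact hω
    refine isUpperSet_originToBoundary d m ?_ (Set.mem_preimage.1 hω')
    intro e he
    rw [mem_restrictConfig] at he
    obtain ⟨⟨e', he', hee'⟩, -⟩ := he
    rwa [← Sym2.map.injective Subtype.val_injective hee']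
  exact h1.trans (h2.trans h3)

/-! ### The initial event has positive probability -/

/-- The initial event `A₀ = {U₀ open}` is increasing. [folklore] -/
theorem isUpperSet_initEvent (S : HSiteScheme (Site d)) : IsUpperSet S.initEvent :=
  fun _ _ hle hω => Set.Subset.trans hω hle

/-- **`φ⁰_{Λ₀,p,q}(U₀ open) > 0`** for `U₀ ⊆ E_{Λ₀}`, `p ∈ (0,1]`, `q ≥ 1`: by finite energy (Grimmett 2006,
Thm (3.1) eq. (3.4), the cell's `rcMeasure_pow_mul_real_preimage_openEdges_le` with `F = E_{Λ₀}`),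
`φ⁰_{Λ₀}(U₀ open) ≥ (p/(p+q(1-p)))^{|E_{Λ₀}|} · φ⁰_{Λ₀}(Ω) > 0`. [cite: Grimmett2006, Thm. (3.1) (3.4)] -/
theorem regionFreeReal_initEvent_pos {S : HSiteScheme (Site d)} {Λ₀ : Finset (Site d)}
    (hU : (↑S.U₀ : Set (Sym2 (Site d))) ⊆ ↑(edgesIn (zdGraph d) Λ₀)) {p q : ℝ}
    (hp : p ∈ Set.Ioc (0 : ℝ) 1) (hq : 1 ≤ q) : 0 < regionFreeReal d p q Λ₀ S.initEvent := by
  have hp' : p ∈ Set.Icc (0 : ℝ) 1 := ⟨hp.1.le, hp.2⟩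
  have hq0 : 0 < q := one_pos.trans_le hq
  haveI := isProbabilityMeasure_rcMeasure (finsetGraph (zdGraph d) Λ₀) hp' hq0 (∅ : Set ↥Λ₀)
  have hfe := rcMeasure_pow_mul_real_preimage_openEdges_le (finsetGraph (zdGraph d) Λ₀) hp' hq (∅ : Set ↥Λ₀)
    (F := (finsetGraph (zdGraph d) Λ₀).edgeFinset) subset_rfl (liftEdges Λ₀ ⁻¹' S.initEvent)
  have huniv : openEdges (↑(finsetGraph (zdGraph d) Λ₀).edgeFinset : Set (Sym2 ↥Λ₀)) ⁻¹'
      (liftEdges Λ₀ ⁻¹' S.initEvent) = Set.univ := by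
    refine Set.eq_univ_of_forall fun ω => ?_
    change (↑S.U₀ : Set (Sym2 (Site d))) ⊆ liftEdges Λ₀ (ω ∪ ↑(finsetGraph (zdGraph d) Λ₀).edgeFinset)
    intro e he
    have he' := hU he
    rw [Finset.mem_coe, mem_edgesIn_iff] at he'
    obtain ⟨heE, hverts⟩ := he'
    induction e using Sym2.ind with
    | h a b =>
      have ha : a ∈ Λ₀ := hverts a (Sym2.mem_mk_left a b)
      have hb : b ∈ Λ₀ := hverts b (Sym2.mem_mk_right a b)
      refine mem_liftEdges_iff.2 ⟨s(⟨a, ha⟩, ⟨b, hb⟩), Or.inr ?_, by simp⟩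
      rw [Finset.mem_coe, SimpleGraph.mem_edgeFinset, SimpleGraph.mem_edgeSet, finsetGraph_adj_iff]
      exact (SimpleGraph.mem_edgeSet _).1 heE
  have hden : 0 < p + q * (1 - p) := by nlinarith [hp.1, hp.2, hq]
  have hc : 0 < (p / (p + q * (1 - p))) ^ (finsetGraph (zdGraph d) Λ₀).edgeFinset.card :=
    pow_pos (div_pos hp.1 hden) _
  rw [huniv, probReal_univ, mul_one] at hfe
  exact hc.trans_le hfe

/-- **`P(A₀) > 0` under every `FKGibbs` measure** (`p ∈ (0,1]`, `q ≥ 1`, `U₀ ⊆ E_{Λ₀}`): lower sandwich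
`P(A₀) ≥ φ⁰_{Λ₀,p,q}(A₀)` (Grimmett 2006, (4.21)) and `regionFreeReal_initEvent_pos`.
[cite: Grimmett2006, Thm. (4.19)(c) (4.21) and Thm. (3.1) (3.4)] -/
theorem FKGibbs.initEvent_pos {S : HSiteScheme (Site d)} {Λ₀ : Finset (Site d)}
    (hU : (↑S.U₀ : Set (Sym2 (Site d))) ⊆ ↑(edgesIn (zdGraph d) Λ₀)) {p q : ℝ}
    (hp : p ∈ Set.Ioc (0 : ℝ) 1) (hq : 1 ≤ q) {P : Measure (BondConfig (Site d))} (hG : FKGibbs d p q P) :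
    0 < P.real S.initEvent :=
  (regionFreeReal_initEvent_pos hU hp hq).trans_le
    (hG.regionFreeReal_le Λ₀ (isUpperSet_initEvent S) (determinedBy_initEvent.mono hU))

/-! ### The continuation principle -/

namespace RegionLawful

variable {S : HSiteScheme (Site d)} {p q : ℝ} {M : ℕ} {ε : ℝ}

/-- **Percolation under every `FKGibbs` measure at the SAME `p`**: a region-lawful scheme at `(p, ε)` with
`ε ≤ 2⁻³²`, `p ∈ (0,1]`, `q ≥ 1`, whose infinite final macro-cluster forces `0 ↔ ∞` (off a set of non-lattice
configurations), gives `P(0 ↔ ∞) ≥ P(A₀)/3 > 0` for every `FKGibbs d p q P` (files 1–2: conditional Peierls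
driver; `condLawful`; `FKGibbs.initEvent_pos`). [cite: KozmaNitzan2024, §4 p. 25 ("P(lim |G_i| = ∞) > 0")] -/
theorem forall_fkGibbs_percolates (hR : RegionLawful S p q M ε) (hε : ε ≤ (1 / 2) ^ 32)
    (hp : p ∈ Set.Ioc (0 : ℝ) 1) (hq : 1 ≤ q)
    (hperc : S.initEvent ∩ {ω | (S.occFinal ω).Infinite} ⊆
      percolatesAt (0 : Site d) ∪ {ω | ¬ω ⊆ (zdGraph d).edgeSet})
    {P : Measure (BondConfig (Site d))} (hG : FKGibbs d p q P) : 0 < P.real (percolatesAt (0 : Site d)) := by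
  haveI := hG.isProbabilityMeasure
  obtain ⟨Λ₀, hU⟩ := hR.init
  have hL := hR.condLawful ⟨hp.1.le, hp.2⟩ (one_pos.trans_le hq) hG
  have h3 := hL.measureReal_initEvent_le_three_mul_percolatesAt hε hperc
  have hA0 := FKGibbs.initEvent_pos hU hp hq hG
  linarith

/-- **The same-`p` continuation principle for the random-cluster model, `q ≥ 1` (C2).** A region-lawful
scheme at `(p, ε)` with `ε < 2⁻³²`, regions of at most `M` sites, `p ∈ (0,1)`, whose infinite final macro-cluster
forces `0 ↔ ∞`, yields a density `p′ < p` (indeed every `p′ ∈ [p - η, p]` for an explicit `η > 0`) at which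
EVERY `FKGibbs` measure percolates: the same scheme is region-lawful at `(p′, ε′ ≤ 2⁻³²)` by `of_near`, and
`forall_fkGibbs_percolates` applies at `p′`.  The `q = 1` statement is the tree's `SameP.criticalProb_lt_of_lawful`.
[cite: KozmaNitzan2024, §1 p. 2 (approach 1: "this would make the set {p : θ(p) > 0} open")] -/
theorem exists_lt_forall_fkGibbs_percolates (hR : RegionLawful S p q M ε) (hε : ε < (1 / 2) ^ 32)
    (hp : p ∈ Set.Ioo (0 : ℝ) 1) (hq : 1 ≤ q)
    (hperc : S.initEvent ∩ {ω | (S.occFinal ω).Infinite} ⊆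
      percolatesAt (0 : Site d) ∪ {ω | ¬ω ⊆ (zdGraph d).edgeSet}) :
    ∃ p' : ℝ, 0 < p' ∧ p' < p ∧
      ∀ P : Measure (BondConfig (Site d)), FKGibbs d p' q P → 0 < P.real (percolatesAt (0 : Site d)) := by
  have hq0 : 0 < q := one_pos.trans_le hq
  -- a margin `δ` with `p ∈ [δ, 1 - δ]`
  set δ : ℝ := min (p / 2) (1 - p) with hδ
  have hδ0 : 0 < δ := lt_min (by linarith [hp.1]) (by linarith [hp.2])
  have hδp : δ ≤ p / 2 := min_le_left _ _
  have hδ1 : δ ≤ 1 - p := min_le_right _ _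
  have hpI : p ∈ Set.Icc δ (1 - δ) := ⟨by linarith [hp.1], by linarith⟩
  -- the Lipschitz constant and the step `η`
  set L : ℝ := (M.choose 2 : ℝ) / (δ * (1 - δ)) with hL
  have hL0 : 0 ≤ L := div_nonneg (Nat.cast_nonneg _) (mul_nonneg hδ0.le (by linarith [hp.1]))
  set η : ℝ := ((1 / 2 : ℝ) ^ 32 - ε) / (L + 1) with hη
  have hη0 : 0 < η := div_pos (sub_pos.2 hε) (by linarith)
  -- the new density
  set t : ℝ := max (p / 2) (p - η) with ht
  have ht0 : 0 < t := lt_max_of_lt_left (by linarith [hp.1])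
  have htp : t < p := max_lt (by linarith [hp.1]) (by linarith)
  have htI : t ∈ Set.Icc δ (1 - δ) := ⟨hδp.trans (le_max_left _ _), by linarith [hpI.2]⟩
  have htη : |t - p| ≤ η := by
    rw [abs_sub_comm, abs_of_nonneg (by linarith)]
    linarith [le_max_right (p / 2) (p - η)]
  refine ⟨t, ht0, htp, fun P hG => ?_⟩
  -- the scheme is region-lawful at `t` with `ε' ≤ 2⁻³²`
  have hR' := hR.of_near hq0 hδ0 hpI htI
  have hε' : ε + (M.choose 2 : ℝ) / (δ * (1 - δ)) * |t - p| ≤ (1 / 2) ^ 32 := by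
    have h1 : L * |t - p| ≤ L * η := mul_le_mul_of_nonneg_left htη hL0
    have h2 : L * η ≤ (L + 1) * η := by nlinarith
    have hL1 : L + 1 ≠ 0 := ne_of_gt (by linarith)
    have h3 : (L + 1) * η = (1 / 2) ^ 32 - ε := by
      rw [hη]; field_simp
    show ε + L * |t - p| ≤ (1 / 2) ^ 32
    linarith
  exact hR'.forall_fkGibbs_percolates hε' ⟨ht0, htI.2.trans (by linarith)⟩ hq hperc hG

/-- **C2, critical-point form: a region-lawful bounded scheme at `p` forces `p_c(q) < p`** (`q ≥ 1`,
`p ∈ (0,1)`, `ε < 2⁻³²`): at the density `p′ < p` of `exists_lt_forall_fkGibbs_percolates`, any `FKGibbs`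
measure `P′` has `0 < P′(0 ↔ ∞) ≤ θ¹(p′, q)` (`real_percolatesAt_le_thetaWired`), so `p_c(q) ≤ p′ < p` by
monotonicity of `θ¹` (Grimmett 2006 (5.2), the tree's `rcCriticalProb_le_of_thetaWired_pos`).  The existence
of an `FKGibbs` measure at every density (hypothesis `hex`) is the cell's rows FO-06a-2/FO-06b
(`IsBoxLimit.fkGibbs`, `isBoxLimit_rcLimit`: the limit free measure `φ⁰_{p′,q}` qualifies).
[cite: KozmaNitzan2024, §1 p. 2 (approach 1)] -/
theorem rcCriticalProb_lt (hR : RegionLawful S p q M ε) (hε : ε < (1 / 2) ^ 32)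
    (hp : p ∈ Set.Ioo (0 : ℝ) 1) (hq : 1 ≤ q)
    (hperc : S.initEvent ∩ {ω | (S.occFinal ω).Infinite} ⊆
      percolatesAt (0 : Site d) ∪ {ω | ¬ω ⊆ (zdGraph d).edgeSet})
    (hex : ∀ p' ∈ Set.Icc (0 : ℝ) 1, ∃ P : Measure (BondConfig (Site d)), FKGibbs d p' q P) :
    rcCriticalProb d q < p := by
  obtain ⟨p', hp'0, hp'p, hall⟩ := hR.exists_lt_forall_fkGibbs_percolates hε hp hq hperc
  have hp'I : p' ∈ Set.Icc (0 : ℝ) 1 := ⟨hp'0.le, hp'p.le.trans hp.2.le⟩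
  obtain ⟨P, hG⟩ := hex p' hp'I
  have hθ : 0 < thetaWired d p' q :=
    (hall P hG).trans_le (real_percolatesAt_le_thetaWired hG hp'I (one_pos.trans_le hq))
  exact (rcCriticalProb_le_of_thetaWired_pos hq hp'I hθ).trans_lt hp'p

end RegionLawful

/-- **The closing form (no region-lawful bounded scheme at `p_c(q)`).** If `0 < p_c(q) < 1` and an `FKGibbs`
measure exists at every density, then NO history-driven scheme is region-lawful at `(p_c(q), ε)` with
`ε < 2⁻³²` and an infinite macro-cluster forcing `0 ↔ ∞` — the random-cluster form of the tree's
`SameP.theta_criticalProb_eq_zero_of_schemes` read contrapositively: the route to `θ⁰(p_c(q), q) = 0` is to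
BUILD such a scheme from `θ⁰(p,q) > 0` at every `p` (cell crux C3), which is therefore impossible at `p_c`
itself. [cite: KozmaNitzan2024, §1 p. 2 (approach 1)] -/
theorem not_regionLawful_rcCriticalProb {q : ℝ} (hq : 1 ≤ q)
    (hpc : rcCriticalProb d q ∈ Set.Ioo (0 : ℝ) 1)
    (hex : ∀ p' ∈ Set.Icc (0 : ℝ) 1, ∃ P : Measure (BondConfig (Site d)), FKGibbs d p' q P)
    (S : HSiteScheme (Site d)) (M : ℕ) {ε : ℝ} (hε : ε < (1 / 2) ^ 32)
    (hperc : S.initEvent ∩ {ω | (S.occFinal ω).Infinite} ⊆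
      percolatesAt (0 : Site d) ∪ {ω | ¬ω ⊆ (zdGraph d).edgeSet}) :
    ¬RegionLawful S (rcCriticalProb d q) q M ε := fun hR =>
  lt_irrefl _ (hR.rcCriticalProb_lt hε hpc hq hperc hex)

end SameP

end Summit.CriticalPhenomena.PercolationContinuityZ3.Theorems.FK

end
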